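import Mathlib
import Summits.Ventures.PercRepro2.HCov
import Summits.Ventures.PercRepro2.RECMReduction
import Summits.Ventures.PercRepro2.CutVertexPaths
import Summits.Ventures.PercRepro2.GcSkelRules
import Summits.Ventures.PercRepro2.GcSkelReduction
import Summits.Ventures.PercRepro2.GcSkelReductionC
import Summits.Ventures.PercRepro2.GcSkelReductionI
import Summits.Ventures.PercRepro2.GcSkelCutShape

/-!
# The one open shape at a cut vertex of the residual — the `2 + 3` closers (blind cell PercRepro2,
typer-1 g53)

The `twoThree` clause of `WRed.WReducedC` forbids every `2 + 3` split of the five marks at a cut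
vertex (`WRed.TwoThree`, ten disjuncts, a mark at the cut vertex counting on either side). Here
each disjunct is a closer taking the five one-sided placements in the disjunct's order —
**`twoThree_1` … `twoThree_10`** (the pair on the left) and the mirrors **`twoThree_1'` …
`twoThree_10'`** (the pair on the right, by `CutVertex.symm`) — for the case analysis of
`GcSkelCutShapeMain.lean`.
-/

namespace Summit.Ventures.PercRepro2

open CovForm RECM CutVertexM9

namespace WRed

section Splits

variable {V : Type*} {E : Type*} [Fintype E] [DecidableEq V]
variable {ends : E → Sym2 V} {side : E → Bool} {L : Set V} {v : V} {Rt : Set V} {o a₁ a₂ a₃ b : V}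

/-- The marks are not split `{a₁, a₂}` left / `{o, a₃, b}` right. -/
lemma twoThree_1 (h : WReducedI ends o a₁ a₂ a₃ b) (hcut : CutVertex ends side L v Rt)
    (ha1 : a₁ ∈ L ∨ a₁ = v) (ha2 : a₂ ∈ L ∨ a₂ = v) (ho : o ∈ Rt ∨ o = v) (h3 : a₃ ∈ Rt ∨ a₃ = v)
    (hb : b ∈ Rt ∨ b = v) : False :=
  h.twoThree side L v Rt hcut (by unfold TwoThree; exact Or.inl ⟨ha1, ha2, ho, h3, hb⟩)

/-- The marks are not split `{a₁, a₃}` left / `{o, a₂, b}` right. -/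
lemma twoThree_2 (h : WReducedI ends o a₁ a₂ a₃ b) (hcut : CutVertex ends side L v Rt)
    (ha1 : a₁ ∈ L ∨ a₁ = v) (h3 : a₃ ∈ L ∨ a₃ = v) (ho : o ∈ Rt ∨ o = v) (ha2 : a₂ ∈ Rt ∨ a₂ = v)
    (hb : b ∈ Rt ∨ b = v) : False :=
  h.twoThree side L v Rt hcut (by unfold TwoThree; exact Or.inr (Or.inl ⟨ha1, h3, ho, ha2, hb⟩))

/-- The marks are not split `{a₂, a₃}` left / `{o, a₁, b}` right. -/
lemma twoThree_3 (h : WReducedI ends o a₁ a₂ a₃ b) (hcut : CutVertex ends side L v Rt)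
    (ha2 : a₂ ∈ L ∨ a₂ = v) (h3 : a₃ ∈ L ∨ a₃ = v) (ho : o ∈ Rt ∨ o = v) (ha1 : a₁ ∈ Rt ∨ a₁ = v)
    (hb : b ∈ Rt ∨ b = v) : False :=
  h.twoThree side L v Rt hcut
    (by
      unfold TwoThree
      exact Or.inr (Or.inr (Or.inl ⟨ha2, h3, ho, ha1, hb⟩)))

/-- The marks are not split `{a₁, o}` left / `{a₂, a₃, b}` right. -/
lemma twoThree_4 (h : WReducedI ends o a₁ a₂ a₃ b) (hcut : CutVertex ends side L v Rt)
    (ha1 : a₁ ∈ L ∨ a₁ = v) (ho : o ∈ L ∨ o = v) (ha2 : a₂ ∈ Rt ∨ a₂ = v) (h3 : a₃ ∈ Rt ∨ a₃ = v)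
    (hb : b ∈ Rt ∨ b = v) : False :=
  h.twoThree side L v Rt hcut
    (by
      unfold TwoThree
      exact Or.inr (Or.inr (Or.inr (Or.inl ⟨ha1, ho, ha2, h3, hb⟩))))

/-- The marks are not split `{a₂, o}` left / `{a₁, a₃, b}` right. -/
lemma twoThree_5 (h : WReducedI ends o a₁ a₂ a₃ b) (hcut : CutVertex ends side L v Rt)
    (ha2 : a₂ ∈ L ∨ a₂ = v) (ho : o ∈ L ∨ o = v) (ha1 : a₁ ∈ Rt ∨ a₁ = v) (h3 : a₃ ∈ Rt ∨ a₃ = v)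
    (hb : b ∈ Rt ∨ b = v) : False :=
  h.twoThree side L v Rt hcut
    (by
      unfold TwoThree
      exact Or.inr (Or.inr (Or.inr (Or.inr (Or.inl ⟨ha2, ho, ha1, h3, hb⟩)))))

/-- The marks are not split `{a₁, b}` left / `{a₂, a₃, o}` right. -/
lemma twoThree_6 (h : WReducedI ends o a₁ a₂ a₃ b) (hcut : CutVertex ends side L v Rt)
    (ha1 : a₁ ∈ L ∨ a₁ = v) (hb : b ∈ L ∨ b = v) (ha2 : a₂ ∈ Rt ∨ a₂ = v) (h3 : a₃ ∈ Rt ∨ a₃ = v)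
    (ho : o ∈ Rt ∨ o = v) : False :=
  h.twoThree side L v Rt hcut
    (by
      unfold TwoThree
      exact Or.inr (Or.inr (Or.inr (Or.inr (Or.inr (Or.inl ⟨ha1, hb, ha2, h3, ho⟩))))))

/-- The marks are not split `{a₂, b}` left / `{a₁, a₃, o}` right. -/
lemma twoThree_7 (h : WReducedI ends o a₁ a₂ a₃ b) (hcut : CutVertex ends side L v Rt)
    (ha2 : a₂ ∈ L ∨ a₂ = v) (hb : b ∈ L ∨ b = v) (ha1 : a₁ ∈ Rt ∨ a₁ = v) (h3 : a₃ ∈ Rt ∨ a₃ = v)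
    (ho : o ∈ Rt ∨ o = v) : False :=
  h.twoThree side L v Rt hcut
    (by
      unfold TwoThree
      exact Or.inr (Or.inr (Or.inr (Or.inr (Or.inr (Or.inr (Or.inl ⟨ha2, hb, ha1, h3, ho⟩)))))))

/-- The marks are not split `{o, a₃}` left / `{a₁, a₂, b}` right. -/
lemma twoThree_8 (h : WReducedI ends o a₁ a₂ a₃ b) (hcut : CutVertex ends side L v Rt)
    (ho : o ∈ L ∨ o = v) (h3 : a₃ ∈ L ∨ a₃ = v) (ha1 : a₁ ∈ Rt ∨ a₁ = v) (ha2 : a₂ ∈ Rt ∨ a₂ = v)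
    (hb : b ∈ Rt ∨ b = v) : False :=
  h.twoThree side L v Rt hcut
    (by
      unfold TwoThree
      exact Or.inr (Or.inr (Or.inr (Or.inr (Or.inr (Or.inr (Or.inr (Or.inl ⟨ho, h3, ha1, ha2, hb⟩))))))))

/-- The marks are not split `{a₃, b}` left / `{a₁, a₂, o}` right. -/
lemma twoThree_9 (h : WReducedI ends o a₁ a₂ a₃ b) (hcut : CutVertex ends side L v Rt)
    (h3 : a₃ ∈ L ∨ a₃ = v) (hb : b ∈ L ∨ b = v) (ha1 : a₁ ∈ Rt ∨ a₁ = v) (ha2 : a₂ ∈ Rt ∨ a₂ = v)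
    (ho : o ∈ Rt ∨ o = v) : False :=
  h.twoThree side L v Rt hcut
    (by
      unfold TwoThree
      exact Or.inr (Or.inr (Or.inr (Or.inr (Or.inr (Or.inr (Or.inr (Or.inr (Or.inl ⟨h3, hb, ha1, ha2, ho⟩)))))))))

/-- The marks are not split `{o, b}` left / `{a₁, a₂, a₃}` right. -/
lemma twoThree_10 (h : WReducedI ends o a₁ a₂ a₃ b) (hcut : CutVertex ends side L v Rt)
    (ho : o ∈ L ∨ o = v) (hb : b ∈ L ∨ b = v) (ha1 : a₁ ∈ Rt ∨ a₁ = v) (ha2 : a₂ ∈ Rt ∨ a₂ = v)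
    (h3 : a₃ ∈ Rt ∨ a₃ = v) : False :=
  h.twoThree side L v Rt hcut
    (by
      unfold TwoThree
      exact Or.inr (Or.inr (Or.inr (Or.inr (Or.inr (Or.inr (Or.inr (Or.inr (Or.inr ⟨ho, hb, ha1, ha2, h3⟩)))))))))

/-- The marks are not split `{a₁, a₂}` right / `{o, a₃, b}` left. -/
lemma twoThree_1' (h : WReducedI ends o a₁ a₂ a₃ b) (hcut : CutVertex ends side L v Rt)
    (ha1 : a₁ ∈ Rt ∨ a₁ = v) (ha2 : a₂ ∈ Rt ∨ a₂ = v) (ho : o ∈ L ∨ o = v) (h3 : a₃ ∈ L ∨ a₃ = v)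
    (hb : b ∈ L ∨ b = v) : False :=
  h.twoThree (fun e => !side e) Rt v L hcut.symm
    (by
      unfold TwoThree
      exact Or.inl ⟨ha1, ha2, ho, h3, hb⟩)

/-- The marks are not split `{a₁, a₃}` right / `{o, a₂, b}` left. -/
lemma twoThree_2' (h : WReducedI ends o a₁ a₂ a₃ b) (hcut : CutVertex ends side L v Rt)
    (ha1 : a₁ ∈ Rt ∨ a₁ = v) (h3 : a₃ ∈ Rt ∨ a₃ = v) (ho : o ∈ L ∨ o = v) (ha2 : a₂ ∈ L ∨ a₂ = v)
    (hb : b ∈ L ∨ b = v) : False :=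
  h.twoThree (fun e => !side e) Rt v L hcut.symm
    (by
      unfold TwoThree
      exact Or.inr (Or.inl ⟨ha1, h3, ho, ha2, hb⟩))

/-- The marks are not split `{a₂, a₃}` right / `{o, a₁, b}` left. -/
lemma twoThree_3' (h : WReducedI ends o a₁ a₂ a₃ b) (hcut : CutVertex ends side L v Rt)
    (ha2 : a₂ ∈ Rt ∨ a₂ = v) (h3 : a₃ ∈ Rt ∨ a₃ = v) (ho : o ∈ L ∨ o = v) (ha1 : a₁ ∈ L ∨ a₁ = v)
    (hb : b ∈ L ∨ b = v) : False :=
  h.twoThree (fun e => !side e) Rt v L hcut.symm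
    (by
      unfold TwoThree
      exact Or.inr (Or.inr (Or.inl ⟨ha2, h3, ho, ha1, hb⟩)))

/-- The marks are not split `{a₁, o}` right / `{a₂, a₃, b}` left. -/
lemma twoThree_4' (h : WReducedI ends o a₁ a₂ a₃ b) (hcut : CutVertex ends side L v Rt)
    (ha1 : a₁ ∈ Rt ∨ a₁ = v) (ho : o ∈ Rt ∨ o = v) (ha2 : a₂ ∈ L ∨ a₂ = v) (h3 : a₃ ∈ L ∨ a₃ = v)
    (hb : b ∈ L ∨ b = v) : False :=
  h.twoThree (fun e => !side e) Rt v L hcut.symm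
    (by
      unfold TwoThree
      exact Or.inr (Or.inr (Or.inr (Or.inl ⟨ha1, ho, ha2, h3, hb⟩))))

/-- The marks are not split `{a₂, o}` right / `{a₁, a₃, b}` left. -/
lemma twoThree_5' (h : WReducedI ends o a₁ a₂ a₃ b) (hcut : CutVertex ends side L v Rt)
    (ha2 : a₂ ∈ Rt ∨ a₂ = v) (ho : o ∈ Rt ∨ o = v) (ha1 : a₁ ∈ L ∨ a₁ = v) (h3 : a₃ ∈ L ∨ a₃ = v)
    (hb : b ∈ L ∨ b = v) : False :=
  h.twoThree (fun e => !side e) Rt v L hcut.symm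
    (by
      unfold TwoThree
      exact Or.inr (Or.inr (Or.inr (Or.inr (Or.inl ⟨ha2, ho, ha1, h3, hb⟩)))))

/-- The marks are not split `{a₁, b}` right / `{a₂, a₃, o}` left. -/
lemma twoThree_6' (h : WReducedI ends o a₁ a₂ a₃ b) (hcut : CutVertex ends side L v Rt)
    (ha1 : a₁ ∈ Rt ∨ a₁ = v) (hb : b ∈ Rt ∨ b = v) (ha2 : a₂ ∈ L ∨ a₂ = v) (h3 : a₃ ∈ L ∨ a₃ = v)
    (ho : o ∈ L ∨ o = v) : False :=
  h.twoThree (fun e => !side e) Rt v L hcut.symm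
    (by
      unfold TwoThree
      exact Or.inr (Or.inr (Or.inr (Or.inr (Or.inr (Or.inl ⟨ha1, hb, ha2, h3, ho⟩))))))

/-- The marks are not split `{a₂, b}` right / `{a₁, a₃, o}` left. -/
lemma twoThree_7' (h : WReducedI ends o a₁ a₂ a₃ b) (hcut : CutVertex ends side L v Rt)
    (ha2 : a₂ ∈ Rt ∨ a₂ = v) (hb : b ∈ Rt ∨ b = v) (ha1 : a₁ ∈ L ∨ a₁ = v) (h3 : a₃ ∈ L ∨ a₃ = v)
    (ho : o ∈ L ∨ o = v) : False :=
  h.twoThree (fun e => !side e) Rt v L hcut.symm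
    (by
      unfold TwoThree
      exact Or.inr (Or.inr (Or.inr (Or.inr (Or.inr (Or.inr (Or.inl ⟨ha2, hb, ha1, h3, ho⟩)))))))

/-- The marks are not split `{o, a₃}` right / `{a₁, a₂, b}` left. -/
lemma twoThree_8' (h : WReducedI ends o a₁ a₂ a₃ b) (hcut : CutVertex ends side L v Rt)
    (ho : o ∈ Rt ∨ o = v) (h3 : a₃ ∈ Rt ∨ a₃ = v) (ha1 : a₁ ∈ L ∨ a₁ = v) (ha2 : a₂ ∈ L ∨ a₂ = v)
    (hb : b ∈ L ∨ b = v) : False :=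
  h.twoThree (fun e => !side e) Rt v L hcut.symm
    (by
      unfold TwoThree
      exact Or.inr (Or.inr (Or.inr (Or.inr (Or.inr (Or.inr (Or.inr (Or.inl ⟨ho, h3, ha1, ha2, hb⟩))))))))

/-- The marks are not split `{a₃, b}` right / `{a₁, a₂, o}` left. -/
lemma twoThree_9' (h : WReducedI ends o a₁ a₂ a₃ b) (hcut : CutVertex ends side L v Rt)
    (h3 : a₃ ∈ Rt ∨ a₃ = v) (hb : b ∈ Rt ∨ b = v) (ha1 : a₁ ∈ L ∨ a₁ = v) (ha2 : a₂ ∈ L ∨ a₂ = v)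
    (ho : o ∈ L ∨ o = v) : False :=
  h.twoThree (fun e => !side e) Rt v L hcut.symm
    (by
      unfold TwoThree
      exact Or.inr (Or.inr (Or.inr (Or.inr (Or.inr (Or.inr (Or.inr (Or.inr (Or.inl ⟨h3, hb, ha1, ha2, ho⟩)))))))))

/-- The marks are not split `{o, b}` right / `{a₁, a₂, a₃}` left. -/
lemma twoThree_10' (h : WReducedI ends o a₁ a₂ a₃ b) (hcut : CutVertex ends side L v Rt)
    (ho : o ∈ Rt ∨ o = v) (hb : b ∈ Rt ∨ b = v) (ha1 : a₁ ∈ L ∨ a₁ = v) (ha2 : a₂ ∈ L ∨ a₂ = v)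
    (h3 : a₃ ∈ L ∨ a₃ = v) : False :=
  h.twoThree (fun e => !side e) Rt v L hcut.symm
    (by
      unfold TwoThree
      exact Or.inr (Or.inr (Or.inr (Or.inr (Or.inr (Or.inr (Or.inr (Or.inr (Or.inr ⟨ho, hb, ha1, ha2, h3⟩)))))))))

end Splits

end WRed

end Summit.Ventures.PercRepro2
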